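import Summits.Ventures.QEC.Census.RefinedIPCertificateLemmas
import Mathlib.Data.List.GetD
import HarnessLib

/-!
# Refined certificates on the evaluation GRID: tensor-factored point sums (definitions and their semantics)

Venture QEC (cell `qec`, rung X1; row 06). The refined certificates of `RefinedIPCertificate.lean` impose the refined
MacWilliams identity of [CalderbankEtAl1998, §7 (ii)] at evaluation points listed in the leaf; the leaf check
`rleafOK` then evaluates, for every unknown `R(a,b,c)` / `R'(a,b,c)`, the sum `Σ_p μ_p · mono(p; a,b,c)` point by
point — `#points × #classes` monomial evaluations, too many for the kernel at the sizes of the β cells (measured: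
`(18,12,3)`, 630 points × 2·1183 classes, exhausts the kernel). This file organises the SAME sums on the canonical
grid `p = (x⁽ⁱ⁾, y⁽ʲ⁾)` (`x⁽ⁱ⁾ = (1, i − ⌊m/2⌋)`, `y⁽ʲ⁾ = (1, j, l)`, `j + l ≤ w₀`): since the refined monomial
factors as `X(x; a) · Y(y; b, c)`, the sums factor as `Σ_i X(x⁽ⁱ⁾; a) · (Σ_j μ_{ij} · Y(y⁽ʲ⁾; b, c))`, computed once
as nested tables (`gridTab`) — a few `10⁵` products instead of `10⁸`. Definitions: the power/monomial tables
(`tab2`, `tab3`, `nodeTab`, `innerTab`, `gridTab`), their lookup semantics (`get2_tab2`, `get3_tab3`, `get3_gridTab`),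
and the double-sum form `gridSum` with its exchange lemma against the box sum (`boxSum_gridSum`). The leaf check and
its soundness are in `RefinedIPCertificateGridSound.lean`. HONEST FRAMING: pure bookkeeping about finite sums; nothing
here certifies a distance. [cite: CalderbankEtAl1998, §7 (ii) (printed p. 28)]; [cite: MacWilliamsSloane1977,
Ch. 17 §4 Thm. 20].
-/

namespace Summit.Ventures.QEC.Census

open Finset Literature.InformationTheory.QuantumCodes

/-! ### 1. Tables and lookups -/

/-- Two-index lookup into a nested list table (missing entries `0`). [folklore] -/
def get2 (T : List (List ℤ)) (b c : ℕ) : ℤ := (T.getD b []).getD c 0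

/-- The `(w+1) × (w+1)` table of a function. [folklore] -/
def tab2 (w : ℕ) (g : ℕ → ℕ → ℤ) : List (List ℤ) :=
  (List.range (w + 1)).map fun b => (List.range (w + 1)).map fun c => g b c

/-- The `(m+1) × (w+1) × (w+1)` table of a function. [folklore] -/
def tab3 (m w : ℕ) (g : ℕ → ℕ → ℕ → ℤ) : List (List (List ℤ)) :=
  (List.range (m + 1)).map fun a => tab2 w (g a)

/-- `getD` of a mapped `range`. [folklore] -/
theorem getD_map_range {α : Type*} (n i : ℕ) (f : ℕ → α) (d : α) (hi : i ≤ n) :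
    ((List.range (n + 1)).map f).getD i d = f i := by
  rw [List.getD_eq_getElem _ _ (by simp; omega)]
  simp

/-- Lookup in `tab2`. [folklore] -/
theorem get2_tab2 (w : ℕ) (g : ℕ → ℕ → ℤ) {b c : ℕ} (hb : b ≤ w) (hc : c ≤ w) : get2 (tab2 w g) b c = g b c := by
  unfold get2 tab2
  rw [getD_map_range w b _ [] hb, getD_map_range w c _ 0 hc]

/-- Lookup in `tab3`. [folklore] -/
theorem get3_tab3 (m w : ℕ) (g : ℕ → ℕ → ℕ → ℤ) {a b c : ℕ} (ha : a ≤ m) (hb : b ≤ w) (hc : c ≤ w) :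
    get3 (tab3 m w g) a b c = g a b c := by
  unfold get3 tab3
  rw [getD_map_range m a _ [] ha]
  exact get2_tab2 w (g a) hb hc

/-! ### 2. The grid: x-part, y-part, and the factored monomial -/

/-- The x-part `x₀^{m−a} x₁^{a}` of the refined monomial. [cite: CalderbankEtAl1998, §7 (ii)] -/
def xPart (m : ℕ) (x : ℤ × ℤ) (a : ℕ) : ℤ := x.1 ^ (m - a) * x.2 ^ a

/-- The y-part `y₀^{w−b−c} y₁^{b} y₂^{c}` of the refined monomial. [cite: CalderbankEtAl1998, §7 (ii)] -/
def yPart (w : ℕ) (y : ℤ × ℤ × ℤ) (b c : ℕ) : ℤ := y.1 ^ (w - b - c) * y.2.1 ^ b * y.2.2 ^ c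

/-- The refined monomial factors: `mono((x,y); a,b,c) = xPart(x; a) · yPart(y; b,c)`. [cite: CalderbankEtAl1998, §7 (ii)] -/
theorem monoAt_eq_xPart_mul_yPart (m w : ℕ) (x : ℤ × ℤ) (y : ℤ × ℤ × ℤ) (a b c : ℕ) :
    monoAt m w (x.1, x.2, y.1, y.2.1, y.2.2) a b c = xPart m x a * yPart w y b c := by
  simp only [monoAt, refMono, xPart, yPart]

/-- The transformed x-part argument `(x₀ + 3x₁, x₀ − x₁)`. [cite: CalderbankEtAl1998, §7 (ii)] -/
def tX (x : ℤ × ℤ) : ℤ × ℤ := (x.1 + 3 * x.2, x.1 - x.2)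

/-- The transformed y-part argument `(y₀ + y₁ + 2y₂, y₀ + y₁ − 2y₂, y₀ − y₁)`. [cite: CalderbankEtAl1998, §7 (ii)] -/
def tY (y : ℤ × ℤ × ℤ) : ℤ × ℤ × ℤ := (y.1 + y.2.1 + 2 * y.2.2, y.1 + y.2.1 - 2 * y.2.2, y.1 - y.2.1)

/-- `T (x, y) = (tX x, tY y)` componentwise. [cite: CalderbankEtAl1998, §7 (ii)] -/
theorem tPt_eq (x : ℤ × ℤ) (y : ℤ × ℤ × ℤ) :
    tPt (x.1, x.2, y.1, y.2.1, y.2.2) = ((tX x).1, (tX x).2, (tY y).1, (tY y).2.1, (tY y).2.2) := by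
  simp only [tPt, tX, tY]

/-- The grid's x-nodes `(1, i − ⌊m/2⌋)`, `i ≤ m`. [folklore] -/
def gridX (m : ℕ) : List (ℤ × ℤ) := (List.range (m + 1)).map fun i => ((1 : ℤ), (i : ℤ) - ((m / 2 : ℕ) : ℤ))

/-- The grid's y-nodes `(1, j, l)`, `j + l ≤ w` (principal lattice), in a fixed order. [folklore] -/
def gridY (w : ℕ) : List (ℤ × ℤ × ℤ) :=
  (List.range (w + 1)).flatMap fun j => (List.range (w + 1 - j)).map fun l => ((1 : ℤ), (j : ℤ), (l : ℤ))

/-! ### 3. The factored sums -/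

/-- A grid leaf's point data: one multiplier ROW (over the y-nodes) per x-node. The double sum
`Σ_i X(x⁽ⁱ⁾; a) · Σ_j μ_{ij} Y(y⁽ʲ⁾; b,c)` over given node lists (the slow SEMANTICS of the tables below). [folklore] -/
def gridSum (m w : ℕ) (xs : List (ℤ × ℤ)) (ys : List (ℤ × ℤ × ℤ)) (mus : List (List ℤ)) (a b c : ℕ) : ℤ :=
  (List.zipWith (fun x mu => xPart m x a * (List.zipWith (fun y s => s * yPart w y b c) ys mu).sum) xs mus).sum

/-- The y-part table of one node. [folklore] -/
def nodeTab (w : ℕ) (y : ℤ × ℤ × ℤ) : List (List ℤ) := tab2 w (yPart w y)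

/-- The inner table `Σ_j μ_j · Y(y⁽ʲ⁾; b,c)` of one x-node (node tables looked up, not recomputed). [folklore] -/
def innerTab (w : ℕ) (ys : List (ℤ × ℤ × ℤ)) (mu : List ℤ) : List (List ℤ) :=
  let nts := ys.map (nodeTab w)
  tab2 w fun b c => (List.zipWith (fun T s => s * get2 T b c) nts mu).sum

/-- The full table `Σ_i X(x⁽ⁱ⁾; a) · inner_i(b,c)` (x-powers and inner tables looked up). [folklore] -/
def gridTab (m w : ℕ) (xs : List (ℤ × ℤ)) (ys : List (ℤ × ℤ × ℤ)) (mus : List (List ℤ)) : List (List (List ℤ)) :=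
  let xts := xs.map fun x => (List.range (m + 1)).map (xPart m x)
  let its := mus.map (innerTab w ys)
  tab3 m w fun a b c => (List.zipWith (fun X T => X.getD a 0 * get2 T b c) xts its).sum

/-- `zipWith` through two `map`s. [folklore] -/
private theorem zipWith_map_map {α β γ δ ε : Type*} (f : γ → δ → ε) (g : α → γ) (h : β → δ) (l₁ : List α)
    (l₂ : List β) : List.zipWith f (l₁.map g) (l₂.map h) = List.zipWith (fun a b => f (g a) (h b)) l₁ l₂ := by
  induction l₁ generalizing l₂ with
  | nil => simp
  | cons a l₁ ih => cases l₂ <;> simp [ih]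

/-- `zipWith` through a `map` on the left. [folklore] -/
private theorem zipWith_map_left' {α β γ ε : Type*} (f : γ → β → ε) (g : α → γ) (l₁ : List α) (l₂ : List β) :
    List.zipWith f (l₁.map g) l₂ = List.zipWith (fun a b => f (g a) b) l₁ l₂ := by
  induction l₁ generalizing l₂ with
  | nil => simp
  | cons a l₁ ih => cases l₂ <;> simp [ih]

/-- Semantics of the inner table. [folklore] -/
theorem get2_innerTab (w : ℕ) (ys : List (ℤ × ℤ × ℤ)) (mu : List ℤ) {b c : ℕ} (hb : b ≤ w) (hc : c ≤ w) :
    get2 (innerTab w ys mu) b c = (List.zipWith (fun y s => s * yPart w y b c) ys mu).sum := by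
  simp only [innerTab]
  rw [get2_tab2 w _ hb hc, zipWith_map_left']
  have hfg : (fun (y : ℤ × ℤ × ℤ) (s : ℤ) => s * get2 (nodeTab w y) b c) = fun y s => s * yPart w y b c := by
    funext y s; rw [nodeTab, get2_tab2 w _ hb hc]
  rw [hfg]

/-- **Semantics of the grid table**: inside the box, the table entry is the factored double sum.
[folklore] -/
theorem get3_gridTab (m w : ℕ) (xs : List (ℤ × ℤ)) (ys : List (ℤ × ℤ × ℤ)) (mus : List (List ℤ)) {a b c : ℕ}
    (ha : a ≤ m) (hb : b ≤ w) (hc : c ≤ w) : get3 (gridTab m w xs ys mus) a b c = gridSum m w xs ys mus a b c := by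
  simp only [gridTab, gridSum]
  rw [get3_tab3 m w _ ha hb hc, zipWith_map_map]
  have hfg : (fun (x : ℤ × ℤ) (mu : List ℤ) => ((List.range (m + 1)).map (xPart m x)).getD a 0 * get2 (innerTab w ys mu) b c)
      = fun x mu => xPart m x a * (List.zipWith (fun y s => s * yPart w y b c) ys mu).sum := by
    funext x mu; rw [getD_map_range m a _ 0 ha, get2_innerTab w ys mu hb hc]
  rw [hfg]

/-! ### 4. Exchanging the grid sum with the box sum -/

/-- Inner exchange: one x-node against all y-nodes. [folklore] -/
theorem boxSum_inner (n w₀ : ℕ) (x : ℤ × ℤ) (ys : List (ℤ × ℤ × ℤ)) (mu : List ℤ) (X : ℕ → ℕ → ℕ → ℤ) :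
    boxSum n w₀ (fun a b c =>
      (if b + c ≤ w₀ then xPart (n - w₀) x a * (List.zipWith (fun y s => s * yPart w₀ y b c) ys mu).sum else 0) *
        X a b c) =
      (List.zipWith (fun y s =>
        s * boxSum n w₀ (fun a b c => if b + c ≤ w₀ then X a b c * (xPart (n - w₀) x a * yPart w₀ y b c) else 0))
          ys mu).sum := by
  induction ys generalizing mu with
  | nil =>
    unfold boxSum; simp
  | cons y ys ih =>
    cases mu with
    | nil => unfold boxSum; simp
    | cons s mu =>
      simp only [List.zipWith_cons_cons, List.sum_cons]
      rw [← ih mu, ← boxSum_mul, ← boxSum_add]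
      unfold boxSum
      refine Finset.sum_congr rfl fun a _ => Finset.sum_congr rfl fun b _ => Finset.sum_congr rfl fun c _ => ?_
      beta_reduce
      split_ifs <;> ring

/-- **The grid sum against the unknowns equals the sum of the refined polynomial at the grid points**:
`boxSum (λ abc, [b+c ≤ w₀] · gridSum(xs,ys,μ)(a,b,c) · X(a,b,c)) = Σ_i Σ_j μ_{ij} · boxSum([b+c ≤ w₀] X · mono((xᵢ,yⱼ); ·))`.
[folklore] -/
theorem boxSum_gridSum (n w₀ : ℕ) (xs : List (ℤ × ℤ)) (ys : List (ℤ × ℤ × ℤ)) (mus : List (List ℤ))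
    (X : ℕ → ℕ → ℕ → ℤ) :
    boxSum n w₀ (fun a b c => (if b + c ≤ w₀ then gridSum (n - w₀) w₀ xs ys mus a b c else 0) * X a b c) =
      (List.zipWith (fun x mu => (List.zipWith (fun y s =>
        s * boxSum n w₀ (fun a b c => if b + c ≤ w₀ then X a b c * (xPart (n - w₀) x a * yPart w₀ y b c) else 0))
          ys mu).sum) xs mus).sum := by
  induction xs generalizing mus with
  | nil => unfold boxSum gridSum; simp
  | cons x xs ih =>
    cases mus with
    | nil => unfold boxSum gridSum; simp
    | cons mu mus =>
      simp only [List.zipWith_cons_cons, List.sum_cons]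
      rw [← ih mus, ← boxSum_inner, ← boxSum_add]
      unfold boxSum gridSum
      refine Finset.sum_congr rfl fun a _ => Finset.sum_congr rfl fun b _ => Finset.sum_congr rfl fun c _ => ?_
      beta_reduce
      simp only [List.zipWith_cons_cons, List.sum_cons]
      split_ifs <;> ring

/-! ### 5. The grid identity -/

section Soundness

variable {n k d e w₀ : ℕ} {A B W : ℕ → ℕ} {R Rp : ℕ → ℕ → ℕ → ℕ}

/-- `c · Σ zipWith f = Σ zipWith (c · f)`. [folklore] -/
private theorem mul_sum_zipWith {α β : Type*} (cst : ℤ) (f : α → β → ℤ) (l₁ : List α) (l₂ : List β) :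
    cst * (List.zipWith f l₁ l₂).sum = (List.zipWith (fun a b => cst * f a b) l₁ l₂).sum := by
  induction l₁ generalizing l₂ with
  | nil => simp
  | cons a l₁ ih =>
    cases l₂ with
    | nil => simp
    | cons b l₂ => simp only [List.zipWith_cons_cons, List.sum_cons, mul_add, ih]

/-- `Σ zipWith f − Σ zipWith g = Σ zipWith (f − g)` (same lists). [folklore] -/
private theorem sum_zipWith_sub {α β : Type*} (f g : α → β → ℤ) (l₁ : List α) (l₂ : List β) :
    (List.zipWith f l₁ l₂).sum - (List.zipWith g l₁ l₂).sum = (List.zipWith (fun a b => f a b - g a b) l₁ l₂).sum := by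
  induction l₁ generalizing l₂ with
  | nil => simp
  | cons a l₁ ih =>
    cases l₂ with
    | nil => simp
    | cons b l₂ => simp only [List.zipWith_cons_cons, List.sum_cons, ← ih]; ring

/-- A `zipWith`-sum of terms that are all zero vanishes. [folklore] -/
private theorem sum_zipWith_eq_zero {α β : Type*} (f : α → β → ℤ) (l₁ : List α) (l₂ : List β)
    (h : ∀ a b, f a b = 0) : (List.zipWith f l₁ l₂).sum = 0 := by
  induction l₁ generalizing l₂ with
  | nil => simp
  | cons a l₁ ih => cases l₂ <;> simp [h, ih]

/-- `zipWith` through a `map` on the left (local copy). [folklore] -/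
private theorem zipWith_map_left'' {α β γ ε : Type*} (f : γ → β → ε) (g : α → γ) (l₁ : List α) (l₂ : List β) :
    List.zipWith f (l₁.map g) l₂ = List.zipWith (fun a b => f (g a) b) l₁ l₂ := by
  induction l₁ generalizing l₂ with
  | nil => simp
  | cons a l₁ ih => cases l₂ <;> simp [ih]

/-- **The grid identity**: against any solution of the refined system, the tabulated point sums satisfy
`boxSum([tri]·2^{n−k}·TP·R' − [tri]·TT·R) = 0` — the refined MacWilliams identity at every grid point, summed with
the multipliers `μ_{ij}`. [cite: CalderbankEtAl1998, §7 (ii) (printed p. 28)] -/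
theorem grid_identity (href : CRSSRefinedSystem n k d w₀ A B R Rp) (mus : List (List ℤ)) :
    boxSum n w₀ (fun a b c =>
      (if b + c ≤ w₀ then (2 : ℤ) ^ (n - k) * get3 (gridTab (n - w₀) w₀ (gridX (n - w₀)) (gridY w₀) mus) a b c else 0) *
          Rp a b c +
        (if b + c ≤ w₀ then -get3 (gridTab (n - w₀) w₀ ((gridX (n - w₀)).map tX) ((gridY w₀).map tY) mus) a b c
          else 0) * R a b c) = 0 := by
  obtain ⟨-, -, hid, -, hsup, -⟩ := href
  -- replace table entries by grid sums (indices in the box)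
  have hrw : boxSum n w₀ (fun a b c =>
      (if b + c ≤ w₀ then (2 : ℤ) ^ (n - k) * get3 (gridTab (n - w₀) w₀ (gridX (n - w₀)) (gridY w₀) mus) a b c else 0) *
          Rp a b c +
        (if b + c ≤ w₀ then -get3 (gridTab (n - w₀) w₀ ((gridX (n - w₀)).map tX) ((gridY w₀).map tY) mus) a b c
          else 0) * R a b c) =
      (2 : ℤ) ^ (n - k) * boxSum n w₀ (fun a b c =>
        (if b + c ≤ w₀ then gridSum (n - w₀) w₀ (gridX (n - w₀)) (gridY w₀) mus a b c else 0) * Rp a b c) -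
      boxSum n w₀ (fun a b c =>
        (if b + c ≤ w₀ then gridSum (n - w₀) w₀ ((gridX (n - w₀)).map tX) ((gridY w₀).map tY) mus a b c else 0) *
          R a b c) := by
    rw [← boxSum_mul]
    unfold boxSum
    rw [← Finset.sum_sub_distrib]
    refine Finset.sum_congr rfl fun a ha => ?_
    rw [← Finset.sum_sub_distrib]
    refine Finset.sum_congr rfl fun b hb => ?_
    rw [← Finset.sum_sub_distrib]
    refine Finset.sum_congr rfl fun c hc => ?_
    have ha' : a ≤ n - w₀ := Nat.lt_succ_iff.1 (mem_range.1 ha)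
    have hb' : b ≤ w₀ := Nat.lt_succ_iff.1 (mem_range.1 hb)
    have hc' : c ≤ w₀ := Nat.lt_succ_iff.1 (mem_range.1 hc)
    beta_reduce
    rw [get3_gridTab _ _ _ _ _ ha' hb' hc', get3_gridTab _ _ _ _ _ ha' hb' hc']
    split_ifs <;> ring
  rw [hrw, boxSum_gridSum, boxSum_gridSum, zipWith_map_left'', mul_sum_zipWith, sum_zipWith_sub]
  refine sum_zipWith_eq_zero _ _ _ fun x mu => ?_
  rw [zipWith_map_left'', mul_sum_zipWith, sum_zipWith_sub]
  refine sum_zipWith_eq_zero _ _ _ fun y s => ?_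
  -- one grid point: `s · (2^{n−k} refPoly R'(p) − refPoly R (T p)) = 0`
  have hP := (refPoly_tri (R := R) (Rp := Rp) hsup (x.1, x.2, y.1, y.2.1, y.2.2)).2
  have hT := (refPoly_tri (R := R) (Rp := Rp) hsup (tPt (x.1, x.2, y.1, y.2.1, y.2.2))).1
  have hmonoP : ∀ a b c, (Rp a b c : ℤ) * monoAt (n - w₀) w₀ (x.1, x.2, y.1, y.2.1, y.2.2) a b c =
      Rp a b c * (xPart (n - w₀) x a * yPart w₀ y b c) := fun a b c => by rw [monoAt_eq_xPart_mul_yPart]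
  have hmonoT : ∀ a b c, (R a b c : ℤ) * monoAt (n - w₀) w₀ (tPt (x.1, x.2, y.1, y.2.1, y.2.2)) a b c =
      R a b c * (xPart (n - w₀) (tX x) a * yPart w₀ (tY y) b c) := fun a b c => by
    rw [tPt_eq, monoAt_eq_xPart_mul_yPart]
  simp only [hmonoP] at hP
  simp only [hmonoT] at hT
  rw [hP, hT]
  have := hid x.1 x.2 y.1 y.2.1 y.2.2
  simp only [tPt] at this ⊢
  rw [← this]
  ring


end Soundness

end Summit.Ventures.QEC.Census
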